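import Literature.AnabelianGeometry.EtaleTheta.Discharge.Sec2PiXIntoPiC
import Literature.AnabelianGeometry.EtaleTheta.Discharge.Sec1Prop18
import Literature.AnabelianGeometry.EtaleTheta.EtaleThetaClass
import HarnessLib

/-!
# [EtTh] §2 over §1: the TEMPERED side of the cover model — `Π^tp_X, Π^tp_Y, Π^tp_Ÿ, Π^tp_Ċ` inside
# `Π^tp_C` seen from a profinite completion `Π^tp_C → Π_C` (proof-only; W3-L2-02, fields of
# `ThetaCovers.TemperedCoverData` at the model)

Mochizuki, *The étale theta function and its Frobenioid-theoretic manifestations*, Publ. RIMS **45**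
(2009), §2, Prop. 2.4 p. 38 (printed 264): "`Π^tp_X`, `Π^tp_C` … the tempered fundamental groups …
`Π^tp_Y ⊆ Π^tp_X` the kernel of `Π^tp_X ↠ Z`", Def. 2.5 (ii) p. 39 "the covering `Ċ^log → C^log`", §1
p. 17 "`Ÿ := Y₂`" [cite: MochizukiEtTh2009, Prop 2.4 p.38].

Cell abc-iut, layer L2, W3-L2-02 (seat abc-iut-L2-d3), PROOF-ONLY (no `def`). abc-iut-L2-t2's record
`ThetaCovers.TemperedCoverData` has, besides its profinite part (`CoverDataAx`: abc-iut-L2-t10's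
`PiCData.coverDataAx` over `MuTwoSettingPiCData`), the TEMPERED fields `Gtp, toHat, PiYtp, PiYtp_le,
isOpen_PiYtp, quotZ, PiYddtp, PiYddtp_le, isOpen_PiYddtp, relIndex_PiYddtp, PiCdot, index_PiCdot,
isOpen_PiCdot, PiCdot_ne`. For `M : MuTwoSetting p`, ANY profinite completion `ιC : Π^tp_C → P_C` and the
transport `Φ : Π_X → P_C` of `ιC ∘ inclX` (`Sec2PiXIntoPiC`), this file PROVES the shapes of those fields
with `Gtp := Π^tp_C = M.GtpC`, `toHat := ιC`, `Π_X := range Φ`: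

* `comap_range_hatInclX` — `ιC⁻¹(Π_X) = Π^tp_X` (`= range inclX`): the tempered `Π_X` IS `Π^tp_X`;
* `Π^tp_Y := inclX(Ker toZ)`: `≤ ιC⁻¹(Π_X)`, open (`e : CLevelData`: open embedding), and
  `quotZ`: `ιC⁻¹(Π_X)/Π^tp_Y ≃ Π^tp_X/Π^tp_Y ≃ ℤ` (`toZ` onto); normality in `Π^tp_C` is
  `CLevelData.map_inclX_GtpY_normal` (MuTwoSettingCLevel, mod abc-iut-L6-d5's `KerToZIsCompactlyGenerated`);
* `Π^tp_Ÿ := inclX(Π^tp_Ÿ)`: `≤ Π^tp_Y`, open, of relative index `2` (abc-iut-L2-t1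
  `relIndex_GtpYdd_GtpY`);
* `Π^tp_Ċ := dotC εZ` (ε_Z admissible, abc-iut-L2-t1): index `2` (`index_dotC`), open, `≠ ιC⁻¹(Π_X)`;
* `comap_closure_map_inclX` / `isOpen_closure_map_inclX` / `index_closure_map_inclX` — for an OPEN
  finite-index `H ≤ Π^tp_X` (e.g. abc-iut-L2-t8's `Π^tp_X̲̲ = C.Huu`), the closure of `ιC(inclX(H))` is open
  in `P_C`, lies in `Π_X`, pulls back to EXACTLY `inclX(H)` and has index `2·[Π^tp_X : H]` (abc-iut-L3
  `comap_topologicalClosure_map` / `isOpen_topologicalClosure_map`): the profinite `Π_{X̲̲}` of a cover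
  chosen on the tempered side, with abc-iut-L2-t2's `OrbitEmbedding.map_Huu` shape.

Nothing here asserts that a `MuTwoSetting` exists; no side is taken on [IUTchIII] Cor. 3.12; typed ≠ proved.
-/

noncomputable section

namespace Literature.AnabelianGeometry.EtaleTheta

open Literature.AnabelianGeometry.SemiGraphs
open _root_.Topology

namespace MuTwoSetting.CLevelData

universe w

variable {p : ℕ} [Fact p.Prime] {M : MuTwoSetting p}
variable {PC : Type w} [Group PC] [TopologicalSpace PC] [IsTopologicalGroup PC]

/-! ### `ιC⁻¹(Π_X) = Π^tp_X` -/

/-- **The tempered `Π_X` is `Π^tp_X`**: the pull-back of `Π_X = Φ(Π̂_X) ⊆ P_C` along `ιC : Π^tp_C → P_C` is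
`inclX(Π^tp_X)` ("`Π^tp_X ⊆ Π^tp_C`", the `X`-member of the tower of Prop. 2.4).
[cite: MochizukiEtTh2009, Prop 2.4 p.38] -/
theorem comap_range_hatInclX (ιC : M.GtpC →ₜ* PC) (hιC : IsProfiniteCompletion ιC)
    (Φ : M.PiHat →ₜ* PC) (hΦ : ∀ x : M.PiTemp, Φ (M.toHat x) = ιC (M.inclX x)) :
    Φ.toMonoidHom.range.comap ιC.toMonoidHom = M.inclX.range := by
  obtain ⟨V, hV, hrange⟩ := exists_openNormal_range_hatInclX_eq ιC hιC Φ hΦ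
  have hVr : Φ.toMonoidHom.range = V.toSubgroup :=
    SetLike.coe_injective (by rw [MonoidHom.coe_range]; exact hrange)
  rw [hVr, hV]

/-- Membership form: `ιC g ∈ Π_X ↔ g ∈ inclX(Π^tp_X)`. [cite: MochizukiEtTh2009, Prop 2.4 p.38] -/
theorem mem_range_hatInclX_iff (ιC : M.GtpC →ₜ* PC) (hιC : IsProfiniteCompletion ιC)
    (Φ : M.PiHat →ₜ* PC) (hΦ : ∀ x : M.PiTemp, Φ (M.toHat x) = ιC (M.inclX x)) (g : M.GtpC) :
    ιC g ∈ Φ.toMonoidHom.range ↔ g ∈ M.inclX.range := by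
  rw [← comap_range_hatInclX ιC hιC Φ hΦ, Subgroup.mem_comap]
  rfl

/-- The image of a subgroup of `Π^tp_X` lies in the tempered `Π_X`. [cite: MochizukiEtTh2009, Prop 2.4 p.38] -/
theorem map_inclX_le_comap_range (ιC : M.GtpC →ₜ* PC) (hιC : IsProfiniteCompletion ιC)
    (Φ : M.PiHat →ₜ* PC) (hΦ : ∀ x : M.PiTemp, Φ (M.toHat x) = ιC (M.inclX x)) (H : Subgroup M.PiTemp) :
    H.map M.inclX ≤ Φ.toMonoidHom.range.comap ιC.toMonoidHom := by
  rw [comap_range_hatInclX ιC hιC Φ hΦ]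
  exact Subgroup.map_le_range _ _

/-- Under the open embedding `inclX` (`e : CLevelData`), the image of an open subgroup of `Π^tp_X` is open
in `Π^tp_C`. [cite: MochizukiEtTh2009, Def 1.7 p.27] -/
theorem isOpen_map_inclX (e : M.CLevelData) {H : Subgroup M.PiTemp} (hH : IsOpen (H : Set M.PiTemp)) :
    IsOpen ((H.map M.inclX : Subgroup M.GtpC) : Set M.GtpC) := by
  rw [Subgroup.coe_map]
  exact e.isOpenEmbedding_inclX.isOpenMap _ hH

/-! ### `Π^tp_Y := inclX(Ker(Π^tp_X ↠ Z))` -/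

/-- `Π^tp_Y ≤ ιC⁻¹(Π_X)` (field `PiYtp_le`). [cite: MochizukiEtTh2009, Prop 2.4 p.38] -/
theorem map_inclX_GtpY_le (ιC : M.GtpC →ₜ* PC) (hιC : IsProfiniteCompletion ιC)
    (Φ : M.PiHat →ₜ* PC) (hΦ : ∀ x : M.PiTemp, Φ (M.toHat x) = ιC (M.inclX x)) :
    M.GtpY.map M.inclX ≤ Φ.toMonoidHom.range.comap ιC.toMonoidHom :=
  map_inclX_le_comap_range ιC hιC Φ hΦ _

/-- `Π^tp_Y` is open in `Π^tp_C` (field `isOpen_PiYtp`; `Ker toZ` is open, field `isOpen_ker_toZ`).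
[cite: MochizukiEtTh2009, Prop 2.4 p.38] -/
theorem isOpen_map_inclX_GtpY (e : M.CLevelData) :
    IsOpen ((M.GtpY.map M.inclX : Subgroup M.GtpC) : Set M.GtpC) :=
  e.isOpen_map_inclX M.isOpen_ker_toZ

/-- **`ιC⁻¹(Π_X)/Π^tp_Y ≅ ℤ`** (field `quotZ`: "the natural quotient `Π^tp_X ↠ Z`", `Z ≅ ℤ`): transport of
`Π^tp_X/Ker toZ ≅ ℤ` (`toZ` onto) along `inclX : Π^tp_X ⥲ inclX(Π^tp_X) = ιC⁻¹(Π_X)`; stated, as the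
field is, under the normality of `Π^tp_Y` in `Π^tp_C` (`CLevelData.map_inclX_GtpY_normal`).
[cite: MochizukiEtTh2009, Prop 2.4 p.38] -/
theorem nonempty_quot_map_inclX_GtpY_mulEquiv (ιC : M.GtpC →ₜ* PC) (hιC : IsProfiniteCompletion ιC)
    (Φ : M.PiHat →ₜ* PC) (hΦ : ∀ x : M.PiTemp, Φ (M.toHat x) = ιC (M.inclX x))
    [(M.GtpY.map M.inclX).Normal] :
    Nonempty (↥(Φ.toMonoidHom.range.comap ιC.toMonoidHom) ⧸
      (M.GtpY.map M.inclX).subgroupOf (Φ.toMonoidHom.range.comap ιC.toMonoidHom) ≃* Multiplicative ℤ) := by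
  classical
  set W : Subgroup M.GtpC := Φ.toMonoidHom.range.comap ιC.toMonoidHom with hWdef
  have hW : W = M.inclX.range := comap_range_hatInclX ιC hιC Φ hΦ
  -- the inverse of `inclX` on `W = range inclX`
  let ρ : ↥M.inclX.range ≃* M.PiTemp := (MonoidHom.ofInjective M.injective_inclX).symm
  have hρ : ∀ y : ↥M.inclX.range, M.inclX (ρ y) = y := fun y =>
    MonoidHom.apply_ofInjective_symm M.injective_inclX y
  let ψ : ↥W →* Multiplicative ℤ :=
    M.toZ.comp (ρ.toMonoidHom.comp (Subgroup.inclusion hW.le))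
  have hψ : ∀ g : ↥W, M.inclX (ρ (Subgroup.inclusion hW.le g)) = (g : M.GtpC) := fun g => hρ _
  have hsurj : Function.Surjective ψ := by
    intro z
    obtain ⟨x, hx⟩ := M.toZ_surjective z
    refine ⟨⟨M.inclX x, hW ▸ ⟨x, rfl⟩⟩, ?_⟩
    have h1 : ρ (Subgroup.inclusion hW.le ⟨M.inclX x, hW ▸ ⟨x, rfl⟩⟩) = x :=
      M.injective_inclX (by rw [hψ])
    change M.toZ (ρ (Subgroup.inclusion hW.le _)) = z
    rw [h1, hx]
  have hker : ψ.ker = (M.GtpY.map M.inclX).subgroupOf W := by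
    ext g
    rw [MonoidHom.mem_ker, Subgroup.mem_subgroupOf]
    change M.toZ (ρ (Subgroup.inclusion hW.le g)) = 1 ↔ _
    rw [← MonoidHom.mem_ker]
    constructor
    · intro h
      exact ⟨_, h, hψ g⟩
    · rintro ⟨y, hy, hyg⟩
      have : ρ (Subgroup.inclusion hW.le g) = y := M.injective_inclX (by rw [hψ, hyg])
      rw [this]
      exact hy
  exact ⟨(QuotientGroup.quotientMulEquivOfEq hker.symm).trans
    (QuotientGroup.quotientKerEquivOfSurjective ψ hsurj)⟩

/-! ### `Π^tp_Ÿ := inclX(Π^tp_Ÿ)` -/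

/-- `Π^tp_Ÿ ≤ Π^tp_Y` (field `PiYddtp_le`). [cite: MochizukiEtTh2009, §1 p.17] -/
theorem map_inclX_GtpYdd_le (M : MuTwoSetting p) : M.GtpYdd.map M.inclX ≤ M.GtpY.map M.inclX :=
  Subgroup.map_mono M.toThetaSetting.GtpYdd_le_GtpY

/-- `Π^tp_Ÿ` is open in `Π^tp_X` for a setting of type `(1, μ₂)` (`Π^tp_Ÿ = Π^tp_{Y_2}`, which is open).
[cite: MochizukiEtTh2009, §1 p.17] -/
theorem isOpen_GtpYdd' (M : MuTwoSetting p) : IsOpen (M.GtpYdd : Set M.PiTemp) := by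
  rw [M.GtpYdd_eq_GtpYN_two]
  exact M.isOpen_GtpYN 2

/-- `Π^tp_Ÿ` is open in `Π^tp_C` (field `isOpen_PiYddtp`). [cite: MochizukiEtTh2009, §1 p.17] -/
theorem isOpen_map_inclX_GtpYdd (e : M.CLevelData) :
    IsOpen ((M.GtpYdd.map M.inclX : Subgroup M.GtpC) : Set M.GtpC) :=
  e.isOpen_map_inclX (isOpen_GtpYdd' M)

/-- `[Π^tp_Y : Π^tp_Ÿ] = 2` inside `Π^tp_C` (field `relIndex_PiYddtp`; abc-iut-L2-t1 `relIndex_GtpYdd_GtpY`,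
`inclX` injective). [cite: MochizukiEtTh2009, §1 p.17] -/
theorem relIndex_map_inclX_GtpYdd (M : MuTwoSetting p) :
    (M.GtpYdd.map M.inclX).relIndex (M.GtpY.map M.inclX) = 2 := by
  rw [Subgroup.relIndex_map_map_of_injective _ _ M.injective_inclX]
  exact M.relIndex_GtpYdd_GtpY

/-! ### `Π^tp_Ċ := dotC ε_Z` -/

/-- `Π^tp_Ċ` is open in `Π^tp_C` (field `isOpen_PiCdot`): it contains the open `inclX(Π^tp_Ÿ)`
(`Π^tp_Ÿ ≤ Π^tp_Ẍ`, field `GtpYdd_le_GtpXdd`). [cite: MochizukiEtTh2009, Def 2.5(ii) p.39] -/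
theorem isOpen_dotC (e : M.CLevelData) (εZ : M.GtpC) : IsOpen ((M.dotC εZ : Subgroup M.GtpC) : Set M.GtpC) :=
  Subgroup.isOpen_mono
    ((Subgroup.map_mono M.GtpYdd_le_GtpXdd).trans
      ((M.map_GtpXdd_le_dotX εZ).trans (M.dotX_le_dotC εZ)))
    (e.isOpen_map_inclX_GtpYdd)

/-- `Π^tp_Ċ ≠ ιC⁻¹(Π_X)` (field `PiCdot_ne`: `Ċ ≠ X` as coverings of `C`; abc-iut-L2-t1 `dotC_ne_range`),
for admissible `ε_Z`. [cite: MochizukiEtTh2009, Def 2.5(ii) p.39] -/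
theorem dotC_ne_comap_range (ιC : M.GtpC →ₜ* PC) (hιC : IsProfiniteCompletion ιC)
    (Φ : M.PiHat →ₜ* PC) (hΦ : ∀ x : M.PiTemp, Φ (M.toHat x) = ιC (M.inclX x)) {εZ : M.GtpC}
    (hZ : M.IsAdmissibleEpsZ εZ) : M.dotC εZ ≠ Φ.toMonoidHom.range.comap ιC.toMonoidHom := by
  rw [comap_range_hatInclX ιC hιC Φ hΦ]
  exact M.dotC_ne_range hZ

/-! ### Profinite closures of open finite-index subgroups of `Π^tp_X` (e.g. `Π^tp_X̲̲`) -/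

/-- For an open finite-index `H ≤ Π^tp_X`, the closure of `ιC(inclX(H))` is OPEN in `P_C` (abc-iut-L3
`isOpen_topologicalClosure_map`; `inclX(H)` is open of finite index in `Π^tp_C`).
[cite: MochizukiEtTh2009, Prop 2.4 p.38] -/
theorem isOpen_closure_map_inclX (e : M.CLevelData) (ιC : M.GtpC →ₜ* PC) (hιC : IsProfiniteCompletion ιC)
    (H : Subgroup M.PiTemp) (hH : IsOpen (H : Set M.PiTemp)) [H.FiniteIndex] :
    IsOpen ((((H.map M.inclX).map ιC.toMonoidHom).topologicalClosure : Subgroup PC) : Set PC) := by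
  haveI := finiteIndex_map_inclX (M := M) H
  exact IsProfiniteCompletion.isOpen_topologicalClosure_map hιC _ (e.isOpen_map_inclX hH)

/-- … it pulls back along `ιC` to EXACTLY `inclX(H)` (abc-iut-L3 `comap_topologicalClosure_map`) — the shape
of abc-iut-L2-t2's `OrbitEmbedding.map_Huu` "`C.Huu.map ι = T.tp T.PiXuu`".
[cite: MochizukiEtTh2009, Prop 2.4 p.38] -/
theorem comap_closure_map_inclX (e : M.CLevelData) (ιC : M.GtpC →ₜ* PC) (hιC : IsProfiniteCompletion ιC)
    (H : Subgroup M.PiTemp) (hH : IsOpen (H : Set M.PiTemp)) [H.FiniteIndex] :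
    (((H.map M.inclX).map ιC.toMonoidHom).topologicalClosure).comap ιC.toMonoidHom = H.map M.inclX := by
  haveI := finiteIndex_map_inclX (M := M) H
  exact IsProfiniteCompletion.comap_topologicalClosure_map hιC _ (e.isOpen_map_inclX hH)

/-- … it lies in `Π_X = range Φ` (which is open, hence closed, and contains `ιC(inclX(H)) = Φ(toHat(H))`).
[cite: MochizukiEtTh2009, Prop 2.4 p.38] -/
theorem closure_map_inclX_le_range (ιC : M.GtpC →ₜ* PC) (hιC : IsProfiniteCompletion ιC)
    (Φ : M.PiHat →ₜ* PC) (hΦ : ∀ x : M.PiTemp, Φ (M.toHat x) = ιC (M.inclX x)) (H : Subgroup M.PiTemp) :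
    ((H.map M.inclX).map ιC.toMonoidHom).topologicalClosure ≤ Φ.toMonoidHom.range := by
  have hopen : IsOpen ((Φ.toMonoidHom.range : Subgroup PC) : Set PC) := by
    rw [MonoidHom.coe_range]
    exact isOpen_range_hatInclX ιC hιC Φ hΦ
  refine Subgroup.topologicalClosure_minimal _ ?_ (Subgroup.isClosed_of_isOpen _ hopen)
  rintro _ ⟨_, ⟨x, hx, rfl⟩, rfl⟩
  exact ⟨M.toHat x, hΦ x⟩

/-- … and has index `[Π^tp_C : inclX(H)] = 2 · [Π^tp_X : H]` in `P_C` (dense range: the index of an open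
subgroup equals that of its pull-back, `Subgroup.index_comap_of_denseRange`).
[cite: MochizukiEtTh2009, Prop 2.4 p.38] -/
theorem index_closure_map_inclX (e : M.CLevelData) (ιC : M.GtpC →ₜ* PC) (hιC : IsProfiniteCompletion ιC)
    (H : Subgroup M.PiTemp) (hH : IsOpen (H : Set M.PiTemp)) [H.FiniteIndex] :
    (((H.map M.inclX).map ιC.toMonoidHom).topologicalClosure).index = 2 * H.index := by
  rw [← Subgroup.index_comap_of_denseRange ιC.toMonoidHom hιC.denseRange _
      (e.isOpen_closure_map_inclX ιC hιC H hH),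
    e.comap_closure_map_inclX ιC hιC H hH, Subgroup.index_map,
    (MonoidHom.ker_eq_bot_iff M.inclX).2 M.injective_inclX, sup_bot_eq, M.index_range_inclX, mul_comm]

end MuTwoSetting.CLevelData

end Literature.AnabelianGeometry.EtaleTheta

end
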